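import Summits.KontsevichZagierPeriods.KontsevichZagierPeriods.Theses.OctahedralSymmetry
import Literature.NumberTheory.Transcendental.KZKernelConjectureForms

/-!
# `LevelFourSectorKernel` (stmt-KontsevichZagierPeriods-9845) is the Kontsevich–Zagier period conjecture

Census theorem for the crux `OctahedralSymmetry.LevelFourSectorKernel` of route `OctahedralSymmetry`
("ENLARGED KERNEL — the honest complement of the sector": `ker KZ.eval ≤ KZ.relations ⊔ closure(Zhao
relators ∪ level-4 (1)×(2) stuffle relators ∪ octahedral-involution relators)`), written by the line lead
seated on it. Nothing here asserts a route item positively; no statement is changed and no definition is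
added.

* `of_kzKernelConjecture`, `of_summit` — UNCONDITIONALLY the kernel form of Conjecture 1
  (`Literature.NumberTheory.Transcendental.KZKernelConjecture`), hence the summit statement
  `KontsevichZagierPeriods` (tree comparison `kzKernelConjecture_iff_isRational`), implies the crux:
  `KZ.relations ≤ KZ.relations ⊔ _`.
* `summit_of` — the crux together with the route's three sibling cruxes `ZhaoRelationInKZ`
  (stmt-9433), `LevelFourStuffleInKZ` (stmt-9434), `OctahedralInvolutionMove` (stmt-9435) gives the summit:
  this is the route's own deciding theorem `closes`.
* `iff_summit_of`, `iff_kzKernelConjecture_of`, `not_iff_not_summit_of` — modulo those three (true,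
  numerically certified identities, staffed as their own items) the crux is EQUIVALENT to the summit and
  to `ker eval = relations`; `not_summit_of_not` — unconditionally, any refutation of the crux is a
  refutation of the summit.

Consequence for the line protocol: every line on this crux is a line on the summit; a stub set closing
`LevelFourSectorKernel` proves `KontsevichZagierPeriods` outright once stmt-9433/9434/9435 land, and no
`¬ LevelFourSectorKernel` is landable short of `¬ KontsevichZagierPeriods`.

References: M. Kontsevich, D. Zagier, *Periods* (2001), §1.2 Conjecture 1; A. Huber, S. Müller-Stach,
*Periods and Nori Motives* (2017), Conj. 13.2.1 (kernel shape).

Maintenance record (full-build repair, 2026-08-17; dependency drift — the file is a RECORD of the retired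
crux). Route `OctahedralSymmetry` rev 9 (route-choice 2026-08-16T13:43Z) DROPPED the crux
`LevelFourSectorKernel` (stmt-9845, closed `moot`) in favour of the shared kernel-form item `KernelForm`
(stmt-10447), and re-signed the deciding theorem as
`closes : ZhaoRelationInKZ → LevelFourStuffleInKZ → OctahedralInvolutionMove → KernelForm → KontsevichZagierPeriods`;
the route file calls this census file obsolete. It is kept compiling, every theorem header unchanged
(Theorems files are append-only), by (1) re-declaring the dropped decl below in the route's namespace with
the item's registered signature VERBATIM (no other module declares that name), and (2) ONE added theorem,
`kernelForm_of` — the rev-8 containment `relations ⊔ closure(relators) ≤ relations` under the three sibling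
cruxes (each adjoined relator family is discharged by its own crux; the involution family lands in
`changeOfVariablesRel ⊆ relations`), i.e. crux + siblings ⇒ `KernelForm` — through which `summit_of` and
`iff_summit_of` now reach the rev-9 `closes`. Proof terms of those two changed accordingly; nothing else.
-/

noncomputable section

/-! ### The retired crux decl, re-declared (route rev 9 dropped it) -/

namespace Summit.KontsevichZagierPeriods.KontsevichZagierPeriods.Theses.OctahedralSymmetry

/-- RETIRED crux decl `LevelFourSectorKernel` (stmt-KontsevichZagierPeriods-9845 of route OctahedralSymmetry,
revs 3–8; closed `moot` and dropped at rev 9, 2026-08-16T13:43Z, for the shared kernel-form item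
`KernelForm`): the ENLARGED KERNEL — every formal `ℤ`-combination `c` of KZ integral representations with
`KZ.eval c = 0` lies in `KZ.relations ⊔ closure(Zhao relators ∪ level-4 (1)×(2)-stuffle relators ∪
octahedral-involution relators)`, the three relator families being spelled out with the data of the sibling
cruxes `ZhaoRelationInKZ` / `LevelFourStuffleInKZ` / `OctahedralInvolutionMove`. Re-declared here, in the
route's namespace and with the item's registered signature verbatim (one line, as the route file rendered
it), solely so that the census theorems below keep elaborating with their statements unchanged; a
route-item definition, not a cited Literature fact, and not asserted. -/
def LevelFourSectorKernel : Prop :=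
  ∀ c : Literature.NumberTheory.Transcendental.KZ.FormalRep, Literature.NumberTheory.Transcendental.KZ.eval c = 0 → c ∈ Literature.NumberTheory.Transcendental.KZ.relations ⊔ AddSubgroup.closure ({d : Literature.NumberTheory.Transcendental.KZ.FormalRep | ∃ (re im : Fin 5 → ℝ → ℝ) (W : Fin 9 → Fin 3 → Fin 5) (cf : Fin 9 → ℤ) (R J : Fin 9 → Literature.NumberTheory.Transcendental.KZ.IntegralRep 3), re = ![fun t => 1 / (t - 1), fun t => t / (1 + t ^ 2), fun t => 1 / (1 + t), fun t => t / (1 + t ^ 2), fun t => 1 / t] ∧ im = ![fun _ => 0, fun t => 1 / (1 + t ^ 2), fun _ => 0, fun t => -1 / (1 + t ^ 2), fun _ => 0] ∧ W = ![![2, 4, 3], ![3, 3, 3], ![2, 0, 3], ![3, 2, 1], ![1, 4, 0], ![1, 3, 3], ![1, 1, 1], ![3, 2, 0], ![4, 1, 1]] ∧ cf = ![-5, -46, 7, 13, 13, 1, -25, 8, 18] ∧ (∀ k, (R k).domain = {t | 1 > t 0 ∧ t 0 > t 1 ∧ t 1 > t 2 ∧ t 2 > 0} ∧ (J k).domain =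 {t | 1 > t 0 ∧ t 0 > t 1 ∧ t 1 > t 2 ∧ t 2 > 0}) ∧ (∀ k, Set.EqOn (R k).integrand (fun t => re (W k 0) (t 0) * re (W k 1) (t 1) * re (W k 2) (t 2) - re (W k 0) (t 0) * im (W k 1) (t 1) * im (W k 2) (t 2) - im (W k 0) (t 0) * re (W k 1) (t 1) * im (W k 2) (t 2) - im (W k 0) (t 0) * im (W k 1) (t 1) * re (W k 2) (t 2)) (R k).domain) ∧ (∀ k, Set.EqOn (J k).integrand (fun t => re (W k 0) (t 0) * re (W k 1) (t 1) * im (W k 2) (t 2) + re (W k 0) (t 0) * im (W k 1) (t 1) * re (W k 2) (t 2) + im (W k 0) (t 0) * re (W k 1) (t 1) * re (W k 2) (t 2) - im (W k 0) (t 0) * im (W k 1) (t 1) * im (W k 2) (t 2)) (J k).domain) ∧ (d = ∑ k, cf k • Literature.NumberTheory.Transcendental.KZ.of (R k) ∨ d = ∑ k, cf k • Literature.NumberTheory.Transcendental.KZ.of (J k))} ∪ {d : Literature.NumberTheory.Transcendental.KZ.FormalRep | ∃ (re im : Fin 4 → ℝ → ℝ) (a b : Fin 4) (P P' A A' B B'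 C C' : Literature.NumberTheory.Transcendental.KZ.IntegralRep 3), re = ![fun t => 1 / (t - 1), fun t => t / (1 + t ^ 2), fun t => 1 / (1 + t), fun t => t / (1 + t ^ 2)] ∧ im = ![fun _ => 0, fun t => 1 / (1 + t ^ 2), fun _ => 0, fun t => -1 / (1 + t ^ 2)] ∧ a ≠ 0 ∧ P.domain = {t | (0 < t 0 ∧ t 0 < 1) ∧ 1 > t 1 ∧ t 1 > t 2 ∧ t 2 > 0} ∧ P'.domain = P.domain ∧ Set.EqOn P.integrand (fun t => (re a (t 0) * re b (t 2) - im a (t 0) * im b (t 2)) / t 1) P.domain ∧ Set.EqOn P'.integrand (fun t => (re a (t 0) * im b (t 2) + im a (t 0) * re b (t 2)) / t 1) P'.domain ∧ A.domain = {t | 1 > t 0 ∧ t 0 > t 1 ∧ t 1 > t 2 ∧ t 2 > 0} ∧ A'.domain = A.domain ∧ B.domain = A.domain ∧ B'.domain = A.domain ∧ C.domain = A.domain ∧ C'.domain = A.domain ∧ Set.EqOn A.integrand (fun t => (re a (t 0) * re (a + b) (t 2) - im a (t 0) * im (a + b) (t 2)) / t 1) A.domain ∧ Set.EqOn A'.integrand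 (fun t => (re a (t 0) * im (a + b) (t 2) + im a (t 0) * re (a + b) (t 2)) / t 1) A'.domain ∧ Set.EqOn B.integrand (fun t => (re b (t 1) * re (a + b) (t 2) - im b (t 1) * im (a + b) (t 2)) / t 0) B.domain ∧ Set.EqOn B'.integrand (fun t => (re b (t 1) * im (a + b) (t 2) + im b (t 1) * re (a + b) (t 2)) / t 0) B'.domain ∧ Set.EqOn C.integrand (fun t => re (a + b) (t 2) / (t 0 * t 1)) C.domain ∧ Set.EqOn C'.integrand (fun t => im (a + b) (t 2) / (t 0 * t 1)) C'.domain ∧ (d = Literature.NumberTheory.Transcendental.KZ.of P - Literature.NumberTheory.Transcendental.KZ.of A - Literature.NumberTheory.Transcendental.KZ.of B + Literature.NumberTheory.Transcendental.KZ.of C ∨ d = Literature.NumberTheory.Transcendental.KZ.of P' - Literature.NumberTheory.Transcendental.KZ.of A' - Literature.NumberTheory.Transcendental.KZ.of B' + Literature.NumberTheory.Transcendental.KZ.of C')} ∪ {d : Literature.NumberTheory.Transcendental.KZ.FormalRep | ∃ (w : ℕ) (r r' : Literature.NumberTheory.Transcendental.KZ.IntegralRep w), r.domain = {t | (∀ i,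 0 < t i) ∧ (∀ i, t i < 1) ∧ StrictAnti t} ∧ r'.domain = {t | (∀ i, 0 < t i) ∧ (∀ i, t i < 1) ∧ StrictAnti t} ∧ (∀ t ∈ r.domain, r.integrand t = r'.integrand (fun j => (1 - t (Fin.rev j)) / (1 + t (Fin.rev j))) * ∏ j, 2 / (1 + t j) ^ 2) ∧ d = Literature.NumberTheory.Transcendental.KZ.of r - Literature.NumberTheory.Transcendental.KZ.of r'})

end Summit.KontsevichZagierPeriods.KontsevichZagierPeriods.Theses.OctahedralSymmetry

namespace Summit.KontsevichZagierPeriods.OctahedralSymmetry.LevelFourSectorKernelStrength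

open Literature.NumberTheory.Transcendental
open Summit.KontsevichZagierPeriods.KontsevichZagierPeriods.Theses.OctahedralSymmetry
  (LevelFourSectorKernel ZhaoRelationInKZ LevelFourStuffleInKZ OctahedralInvolutionMove KernelForm closes)

/-- **Crux + the three sibling cruxes ⇒ the kernel form** (`KernelForm`, stmt-10447: `ker KZ.eval ≤ KZ.relations`):
the containment `KZ.relations ⊔ closure(relators) ≤ KZ.relations` of the rev-8 deciding theorem — each
adjoined relator family is discharged by its own crux (`ZhaoRelationInKZ`, stmt-9433; `LevelFourStuffleInKZ`,
stmt-9434; `OctahedralInvolutionMove`, stmt-9435, whose single change-of-variables move lies in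
`changeOfVariablesRel ⊆ relations`). Added 2026-08-17 (maintenance) so that `summit_of` reaches the rev-9
`closes`. [Kontsevich–Zagier 2001, §1.2 Conjecture 1] [folklore] -/
theorem kernelForm_of (hZ : ZhaoRelationInKZ) (hS : LevelFourStuffleInKZ) (hI : OctahedralInvolutionMove)
    (hC : Summit.KontsevichZagierPeriods.KontsevichZagierPeriods.Theses.OctahedralSymmetry.LevelFourSectorKernel) :
    KernelForm := by
  intro c hc
  refine (sup_le le_rfl ((AddSubgroup.closure_le _).mpr ?_)) (hC c hc)
  rintro d ((hd | hd) | hd)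
  · obtain ⟨re, im, W, cf, R, J, hre, him, hword, hcoef, hdom, hR, hJ, hd⟩ := hd
    have h := hZ re im hre him W cf hword hcoef R J hdom hR hJ
    rcases hd with rfl | rfl
    · exact h.1
    · exact h.2
  · obtain ⟨re, im, a, b, P, P', A, A', B, B', C, C', hre, him, ha, hP, hP', hiP, hiP', hA, hA', hB,
      hB', hC', hC'', hiA, hiA', hiB, hiB', hiC, hiC', hd⟩ := hd
    have h := hS re im hre him a b ha P P' A A' B B' C C' hP hP' hiP hiP' hA hA' hB hB' hC' hC'' hiA
      hiA' hiB hiB' hiC hiC'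
    rcases hd with rfl | rfl
    · exact h.1
    · exact h.2
  · obtain ⟨w, ρ, ρ', hρ, hρ', hint, rfl⟩ := hd
    exact KZ.changeOfVariablesRel_subset_relations (hI w ρ ρ' hρ hρ' hint)

/-- **Kernel form ⇒ crux** (unconditional): if `ker eval = relations` then a fortiori
`ker eval ≤ relations ⊔ closure(relators)`. [Kontsevich–Zagier 2001, §1.2 Conjecture 1] [folklore] -/
theorem of_kzKernelConjecture (hK : KZKernelConjecture) :
    Summit.KontsevichZagierPeriods.KontsevichZagierPeriods.Theses.OctahedralSymmetry.LevelFourSectorKernel :=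
  fun c hc => AddSubgroup.mem_sup_left (hK c hc)

/-- **Summit ⇒ crux** (unconditional), through the tree comparison
`kzKernelConjecture_iff_isRational : KZKernelConjecture ↔ KontsevichZagierPeriods`. [folklore] -/
theorem of_summit (h : KontsevichZagierPeriods) :
    Summit.KontsevichZagierPeriods.KontsevichZagierPeriods.Theses.OctahedralSymmetry.LevelFourSectorKernel :=
  of_kzKernelConjecture
    ((kzKernelConjecture_iff_isRational : KZKernelConjecture ↔ KontsevichZagierPeriods).mpr h)

/-- **Crux + the three sibling cruxes ⇒ summit**: `kernelForm_of` (each adjoined relator family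
discharged by its own crux, stmt-9433, stmt-9434, stmt-9435 — the rev-8 `closes`) followed by the route's
rev-9 deciding theorem `closes` on `KernelForm`. [folklore] -/
theorem summit_of
    (hK : Summit.KontsevichZagierPeriods.KontsevichZagierPeriods.Theses.OctahedralSymmetry.LevelFourSectorKernel)
    (hZ : ZhaoRelationInKZ) (hS : LevelFourStuffleInKZ) (hI : OctahedralInvolutionMove) :
    KontsevichZagierPeriods :=
  closes hZ hS hI (kernelForm_of hZ hS hI hK)

/-- **The crux is the summit** modulo the three sibling cruxes (true identities between absolutely
convergent rational integrals, staffed as items stmt-9433/9434/9435):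
`LevelFourSectorKernel ↔ KontsevichZagierPeriods`. [Kontsevich–Zagier 2001, §1.2 Conjecture 1] [folklore] -/
theorem iff_summit_of (hZ : ZhaoRelationInKZ) (hS : LevelFourStuffleInKZ) (hI : OctahedralInvolutionMove) :
    Summit.KontsevichZagierPeriods.KontsevichZagierPeriods.Theses.OctahedralSymmetry.LevelFourSectorKernel ↔
      KontsevichZagierPeriods :=
  ⟨fun hK => closes hZ hS hI (kernelForm_of hZ hS hI hK), of_summit⟩

/-- … equivalently the kernel form `ker KZ.eval = KZ.relations`. [folklore] -/
theorem iff_kzKernelConjecture_of (hZ : ZhaoRelationInKZ) (hS : LevelFourStuffleInKZ)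
    (hI : OctahedralInvolutionMove) :
    Summit.KontsevichZagierPeriods.KontsevichZagierPeriods.Theses.OctahedralSymmetry.LevelFourSectorKernel ↔
      KZKernelConjecture :=
  (iff_summit_of hZ hS hI).trans
    (kzKernelConjecture_iff_isRational : KZKernelConjecture ↔ KontsevichZagierPeriods).symm

/-- **Anatomy of a refutation**: modulo the three sibling cruxes, `¬ crux` is precisely a disproof of
the summit. [folklore] -/
theorem not_iff_not_summit_of (hZ : ZhaoRelationInKZ) (hS : LevelFourStuffleInKZ)
    (hI : OctahedralInvolutionMove) :
    ¬ Summit.KontsevichZagierPeriods.KontsevichZagierPeriods.Theses.OctahedralSymmetry.LevelFourSectorKernel ↔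
      ¬ KontsevichZagierPeriods :=
  not_congr (iff_summit_of hZ hS hI)

/-- Unconditionally: a refutation of the crux refutes the summit (contrapositive of `of_summit`). [folklore] -/
theorem not_summit_of_not
    (h : ¬ Summit.KontsevichZagierPeriods.KontsevichZagierPeriods.Theses.OctahedralSymmetry.LevelFourSectorKernel) :
    ¬ KontsevichZagierPeriods :=
  fun hs => h (of_summit hs)

/-- Unconditionally: a refutation of the crux exhibits an element of `ker eval` outside `relations`,
i.e. refutes the kernel form of Conjecture 1. [folklore] -/
theorem exists_of_not
    (h : ¬ Summit.KontsevichZagierPeriods.KontsevichZagierPeriods.Theses.OctahedralSymmetry.LevelFourSectorKernel) :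
    ∃ c : KZ.FormalRep, KZ.eval c = 0 ∧ c ∉ KZ.relations := by
  by_contra hne
  push Not at hne
  exact h (of_kzKernelConjecture fun c hc => hne c hc)

end Summit.KontsevichZagierPeriods.OctahedralSymmetry.LevelFourSectorKernelStrength
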